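import Literature.MathematicalPhysics.QuantumFieldTheory.Balaban1983to89.B15Prop1CoerciveEditionNearExt
import Literature.MathematicalPhysics.QuantumFieldTheory.Balaban1983to89.B15Prop1AnalyticExtNearRadius

/-!
# `Balaban1983to89.B15Prop1CoerciveEditionNearRadius` — [Balaban1989LargeFieldI] = «[IV]», (1.74) p. 192, Prop. 1 p. 194; [Balaban1989LargeFieldII] = «[LF-II]», (1.2)–(1.6) p. 357,
# (1.12)–(1.13) p. 359, (1.15) p. 359; [Balaban1988Convergent] = «[III]», (1.3) p. 246, (1.12) p. 248, (2.12)–(2.13) pp. 256–257; [Balaban1985Variational] = «[15]», (5) p. 278, Prop. 9 p. 309: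
# THE (J0′) MINIMISER-FAMILY HEAD OF THE `_ofCoercive` CHAIN WITH THE ANALYTICITY RADIUS IN THE NEAR COUNT (census U3-b — the last torus-volume count of N12's displayed product removed)

Honest framing: statement-level skeleton of published theorems with citation tags; proofs where landed; nothing here is a claim about the Yang–Mills mass gap.  Cell `pub-ymgap`
(HUMAN RULINGS D-0062 ∕ D-0149), lane `pub-ymgap-dag-n12-c` g28 (R134 seat (a), N12 = [B15], s1); count-neutral helper of K1⁹ `stmt-QuantumFields-27364` (`--kind proof --supports`);
N12 NOT discharged; one finite 𝕋⁴ programme at fixed ε; nothing continuum ∕ ℝ⁴ ∕ OS ∕ mass-gap ∕ Clay.  THEOREMS ONLY (0 `def`, 0 `instance`, 0 `sorry`).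

WHAT.  `B15Prop1CoerciveEditionNearExt.…_ofThm1TorusClass_ofMinimiserFamily_ofCoercive_nearExt` (p701805 :476, the Literature head the direct road's FILE B ∕ (P2c)‴ ∕ (D1) ∕ (E1) ∕ v11
key on) with ONE change in the displayed conclusion: the analytic-extension clause's radius reads `#plaqsOf(Ω₁(Z_i))·(1 + 8𝓐₀ i⁴)` (the NEAR plaquette count, `Nat.card` of the subtype —
the currency of its `hcA`∕`hcJ′` rows since the U3 (β)(γ) editions) where it read `Fintype.card (Plaq (F.P Kt) 0)·(1 + 8𝓐₀ i⁴)` (the TORUS count).  BINDERS VERBATIM; no new displayed letter.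

HOW (§2).  The `_nearExt` head itself gives Proposition 1 with the old radius; `B15Prop1AnalyticExtNearRadius.prop1Printed_lfVarOn_std_of_An` upgrades the clause slot once the clause at
the near radius is produced for every regular datum below a threshold — by `anExt_nearRadius_of_jointHolomorphic` fed with: (J1) ∕ (J1ˢ) from (J0′) `hMin`
(`jointHolomorphic_fun177std_bgMSCoPOfRecord_of_minimiserFamily`, `jointHolomorphic_nearValue_bgMSCoPOfRecord_of_minimiserFamily`), `f`'s slice Hessian row = the displayed (1.9) letter
`hcoer`, `f`'s gradient row = `hJ_of_nearValue_nearExt` over the near-value letter (Vn) re-derived from `h15T` exactly as the `_nearExt` chain does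
(`nearValue_letter_of_thm1Guarded_nearCount ∘ thm1Guarded_of_thm1TorusClass`), the value invariance (181) (`fun177std_bgOfRecord_gaugeAct`), and THE TRANSFER LETTER DISCHARGED (§1).

§1 (the transfer letter on the minimiser-family road).  `qsstarGIter0_congr_of_far` — the pull-back `Q_k^{s*}` off `Ω₁(Z)` does not read the `Λ`-variables (the `hfar` mechanism of
`B15Prop1GradientFromNearValue.qsstarGIter0_expMul_ιA_of_far`, for ANY configuration equal to the datum off the bonds meeting `Λ^{(k)}`); `fun177std_eq_nearValue_add_far_of_isMinimizer` —
at a SOLVABLE datum, `A(U_{k,Z}(W)) = A_near(U_{k,Z}(W)) + A_far(Q_k^{s*}W₀)` for `W` equal to `W₀` off the `Λ`-bonds ([LF-II] (1.15), [III] (1.12) «U = V₀ on Ω₁ᶜ» via `isMinimizer_pinned`);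
`exists_expMul_eq_of_dist1` — every configuration bondwise close to `W₀` is `exp(iB′)·W₀` with `‖B′(b)‖ ≤ (π∕2)·dist1` (the global `SU(2)` logarithm `su2Chart.ilog`, Jordan's inequality);
★ `transferLetter_of_minimiserFamily` — the letter of `anExt_nearRadius_of_jointHolomorphic` at radius `ρ = R∕2` from the real points of (J0′) (every such `W` has a solvable datum).

HONEST SCOPE.  Fidelity edition (census U3-b): the radius constant is region-size dependent — with [III] p. 255 ∕ [IV] p. 177 (i) (components in `100MR_k`-cubes) print-legitimate, but NOT
print's `(d, L, M)`-constant ([15] (190) ⇐ (189) decay, untouched); every other row ∕ letter of the head unchanged ((J0′), (1.9), `hfar`, `h15T`, numerics, U4 existential constants); nothing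
of Bałaban's asserted; count-neutral; N12 NOT discharged; K1⁹ NOT closed; R4 closes only the conditional finite-𝕋⁴ rung `BalabanLadder.UV` — no summit statement is proved here and NOT the
Yang–Mills mass gap (Clay); nothing continuum ∕ ℝ⁴ ∕ OS.
-/

noncomputable section

open Set Finset Metric Filter
open scoped BigOperators Matrix RealInnerProductSpace InnerProductSpace Topology

namespace Literature.MathematicalPhysics.QuantumFieldTheory.Balaban1983to89.B15Prop1CoerciveEditionNearRadius

open B15DeterminingSets GaugeField B16Sect1Backgrounds B15Prop1Carrier B8Eq17ClassAkV1 BlockAveraging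
open B15Prop1SliceTaylorCalculus B15Prop1IntrinsicAnalyticExt B15Prop1ParametricZeroBranch B15Prop1IntrinsicOfFun
open B15Prop1GradientFromNearValue B15Prop1Thm1GeneralFormShapes
open B15Prop1JointHolomorphyFromMinimiserFamily B15Prop1CoerciveOfFun B15Prop1CoerciveEditionNearExt B15Prop1NearValueOfMinimiserFamily
open B15Prop1AnalyticExtNearRadius
open B15Prop1AnalyticExtClause (cplxVec cplxSlice norm_cplxVec anExt anExt_antitone)
open B15Prop1ChartCalculusSU2 (E3)
open T4CubeChartGnomonic (SU2)
open B15Prop1ChartSU2 (su2Chart)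
open B15Prop1SliceCoordinates (GaugeSlice ιA freeBonds norm_ιA_apply_le)
open B15Prop1CriticalAtBoxG0 (treeOrder_G0 tgt_G0_mem)
open T4AxialGaugeSmallField (castSite boxPlaqs)
open T4AxialGaugeFixing (TreeOrder boxDepth)
open B7Prop1Explicit (e e_apply)
open B6BondElimination (unitVec)
open B16Eq18Proof (box mem_box)
open B15Extension193 (extend)
open B15ShellGauge193 (shellGauge)
open B14.Eq213MaximalDomains (side)
open B14.Eq213DetSet B14.Eq216Concrete B15Sect1Instances B15Eq177ValueInvariance B16Sect1Wilson
open B14.Eq22Determines (blockIter IsBlockUnion)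
open Literature.MathematicalPhysics.QuantumFieldTheory.BalabanImbrieJaffe1984to88.BIJ85Eq453GaugeField
open T4Continuum
open Classical

/-! ## §1  The transfer letter on the (J0′) minimiser-family road -/

section Transfer

variable {P : Params}

/-- **THE PULL-BACK OFF `Ω₁(Z)` DOES NOT READ THE `Λ`-VARIABLES** (any configuration `W` equal to `W₀` off the bonds meeting `Λ^{(k)}`): under the geometric letter `hfar`,
`Q_k^{s*}W = Q_k^{s*}W₀` on every fine bond starting outside `Ω₁(Z)` — the corridor bond reads the unit-lattice bond `⟨B^k(b₋), μ(b)⟩ ∉ bondsOf Λ^{(k)}`.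
[cite: Balaban1988Convergent, (1.3) p.246, (2.16) p.257; Balaban1989LargeFieldI, (1.74) p.192] -/
theorem qsstarGIter0_congr_of_far {M₁ : ℕ} {Z Λ : Set (Site P 0)} {k : ℕ} (hk : k ≤ P.m + P.K)
    (hfar : ∀ b : PBond P 0, b.src ∉ maxDomT M₁ Z 1 → (⟨blockIter k b.src, b.dir⟩ : PBond P k) ∉ bondsOf (pts k Λ))
    {W W₀ : GaugeField P k SU2} (hW : ∀ c, c ∉ bondsOf (pts k Λ) → W c = W₀ c) (b : PBond P 0) (hb : b.src ∉ maxDomT M₁ Z 1) :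
    qsstarGIter0 k W b = qsstarGIter0 k W₀ b := by
  rw [qsstarGIter0_eq k hk, qsstarGIter0_eq k hk]
  split_ifs with hint
  · rfl
  · exact hW _ (hfar b hb)

/-- **AT A SOLVABLE DATUM, TOTAL = NEAR + THE FAR ACTION OF THE PINNED PULL-BACK** — for `bg := Node00.bgOfRecord av reg`, `0 < k ≤ m + K`, the letter `hfar`, and `W` equal to `W₀` off the
`Λ`-bonds whose (1.74) problem is solvable: `A(U_{k,Z}(W)) = Σ_{p ∈ plaqsOf Ω₁(Z)} (1 − Re tr U_{k,Z}(W)(∂p)) + A_far(Q_k^{s*}W₀)` ([LF-II] (1.15) `A = A(ζ₀) + A(1 − ζ₀)`; the far plaquettes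
read only bonds starting outside `Ω₁(Z)`, where the minimiser is pinned to the datum, [III] (1.12), and the datum there does not read `W↾Λ`).
[cite: Balaban1989LargeFieldII, (1.15) p.359, (1.2)–(1.6) p.357; Balaban1988Convergent, (1.12) p.248, (2.12)–(2.13) pp.256–257; Balaban1989LargeFieldI, (1.74) p.192, (1.77) p.194] -/
theorem fun177std_eq_nearValue_add_far_of_isMinimizer (av : ∀ j, Averaging P j SU2) (reg : Set (GaugeField P 0 SU2)) (M₁ : ℕ) {Z Λ : Set (Site P 0)} {k : ℕ}
    (hk0 : 0 < k) (hk : k ≤ P.m + P.K)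
    (hfar : ∀ b : PBond P 0, b.src ∉ maxDomT M₁ Z 1 → (⟨blockIter k b.src, b.dir⟩ : PBond P k) ∉ bondsOf (pts k Λ))
    {W W₀ : GaugeField P k SU2} (hW : ∀ c, c ∉ bondsOf (pts k Λ) → W c = W₀ c)
    (hsol : ∃ U₀, IsMinimizer av reg (Bj M₁ Z k) (avgFamily av (qsstarGIter0 k W)) U₀) :
    fun177std (Node00.bgOfRecord av reg) M₁ Z k W =
      wilsonLoc ((plaqsOf (maxDomT M₁ Z 1)).indicator fun _ => (1 : ℝ)) (bgKZstd (Node00.bgOfRecord av reg) M₁ Z k W) +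
        wilsonLoc (fun p => 1 - (plaqsOf (maxDomT M₁ Z 1)).indicator (fun _ => (1 : ℝ)) p) (qsstarGIter0 k W₀) := by
  have hζfar : ∀ p : Plaq P 0, 1 - (plaqsOf (maxDomT M₁ Z 1)).indicator (fun _ => (1 : ℝ)) p ≠ 0 → p ∉ plaqsOf (maxDomT M₁ Z 1) := by
    intro p hp hmem
    apply hp
    simp only [Set.indicator_of_mem hmem, sub_self]
  have hU : bgKZstd (Node00.bgOfRecord av reg) M₁ Z k W = Node00.UminOfRecord av reg (Bj M₁ Z k) (avgFamily av (qsstarGIter0 k W)) := by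
    rw [bgKZstd_apply, Node00.bgOfRecord_U]
  have hmin := Node00.isMinimizer_UminOfRecord av reg hsol
  have h1 : wilsonLoc (fun p => 1 - (plaqsOf (maxDomT M₁ Z 1)).indicator (fun _ => (1 : ℝ)) p)
      (Node00.UminOfRecord av reg (Bj M₁ Z k) (avgFamily av (qsstarGIter0 k W))) =
      wilsonLoc (fun p => 1 - (plaqsOf (maxDomT M₁ Z 1)).indicator (fun _ => (1 : ℝ)) p) (qsstarGIter0 k W) :=
    wilsonLoc_congr _ fun p hp => plaqHol_congr_of_not_mem_plaqsOf (fun b hb => isMinimizer_pinned hk0 hmin b hb) (hζfar p hp)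
  have h2 : wilsonLoc (fun p => 1 - (plaqsOf (maxDomT M₁ Z 1)).indicator (fun _ => (1 : ℝ)) p) (qsstarGIter0 k W) =
      wilsonLoc (fun p => 1 - (plaqsOf (maxDomT M₁ Z 1)).indicator (fun _ => (1 : ℝ)) p) (qsstarGIter0 k W₀) :=
    wilsonLoc_congr _ fun p hp => plaqHol_congr_of_not_mem_plaqsOf (fun b hb => qsstarGIter0_congr_of_far hk hfar hW b hb) (hζfar p hp)
  rw [fun177std_eq, hU, eq115 ((plaqsOf (maxDomT M₁ Z 1)).indicator fun _ => (1 : ℝ)), h1, h2]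

/-- **EVERY CONFIGURATION BONDWISE CLOSE TO `W₀` IS `exp(iB′)·W₀` WITH `‖B′(b)‖ ≤ (π∕2)·dist1`** — the global `SU(2)` logarithm (`su2Chart.ilog`, `iexp_ilog`) and Jordan's inequality
(`norm_ilog_le`). [cite: Balaban1989LargeFieldII, p.359 («we get a small configuration, and we can write V′ = exp iB′»)] -/
theorem exists_expMul_eq_of_dist1 {k : ℕ} (W W₀ : GaugeField P k SU2) :
    ∃ B' : VecField P k E3, W = expMul su2Chart B' W₀ ∧ ∀ b, ‖B' b‖ ≤ Real.pi / 2 * dist1 (W b * (W₀ b)⁻¹) := by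
  refine ⟨fun b => su2Chart.ilog (W b * (W₀ b)⁻¹), funext fun b => ?_, fun b => B15Prop1ChartSU2.norm_ilog_le _⟩
  show W b = su2Chart.iexp (su2Chart.ilog (W b * (W₀ b)⁻¹)) * W₀ b
  rw [B15Prop1ChartSU2.iexp_ilog, inv_mul_cancel_right]

/-- ★ **THE TRANSFER LETTER ON THE (J0′) MINIMISER-FAMILY ROAD, DISCHARGED** — for `bg := Node00.bgOfRecord av reg`, `0 < k ≤ m + K`, `hfar`, a datum `W₀` and any radius `R > 0`:
IF every `exp(iB′)·W₀` with `‖B′‖ < R` has a solvable (1.74) problem (the real points of (J0′) `hMin` at one `p`), THEN with `C := A_far(Q_k^{s*}W₀)` every `W` equal to `W₀` off the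
`Λ`-bonds and bondwise `R∕2`-close to `W₀` has `A(U_{k,Z}(W)) = A_near(U_{k,Z}(W)) + C` (`(π∕2)·(R∕2) < R`). [cite: Balaban1989LargeFieldI, (1.74) p.192, (1.77) p.194; Balaban1989LargeFieldII, (1.15) p.359; Balaban1985Variational, (5) p.278, Prop. 9 p.309; Balaban1988Convergent, (2.12) p.256] -/
theorem transferLetter_of_minimiserFamily (av : ∀ j, Averaging P j SU2) (reg : Set (GaugeField P 0 SU2)) (M₁ : ℕ) {Z Λ : Set (Site P 0)} {k : ℕ}
    (hk0 : 0 < k) (hk : k ≤ P.m + P.K)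
    (hfar : ∀ b : PBond P 0, b.src ∉ maxDomT M₁ Z 1 → (⟨blockIter k b.src, b.dir⟩ : PBond P k) ∉ bondsOf (pts k Λ))
    (W₀ : GaugeField P k SU2) {R : ℝ} (hR : 0 < R)
    (hreal : ∀ B' : VecField P k E3, ‖B'‖ < R → ∃ U₀, IsMinimizer av reg (Bj M₁ Z k) (avgFamily av (qsstarGIter0 k (expMul su2Chart B' W₀))) U₀) :
    ∃ C : ℝ, ∀ W : GaugeField P k SU2, (∀ c, c ∉ bondsOf (pts k Λ) → W c = W₀ c) → (∀ b, dist1 (W b * (W₀ b)⁻¹) < R / 2) →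
      fun177std (Node00.bgOfRecord av reg) M₁ Z k W =
        wilsonLoc ((plaqsOf (maxDomT M₁ Z 1)).indicator fun _ => (1 : ℝ)) (bgKZstd (Node00.bgOfRecord av reg) M₁ Z k W) + C := by
  refine ⟨wilsonLoc (fun p => 1 - (plaqsOf (maxDomT M₁ Z 1)).indicator (fun _ => (1 : ℝ)) p) (qsstarGIter0 k W₀), fun W hW hclose => ?_⟩
  -- the datum of `W` is solvable: `W = exp(iB′)·W₀` with `‖B′‖ ≤ (π/2)(R/2) < R`
  obtain ⟨B', hWB, hB'⟩ := exists_expMul_eq_of_dist1 W W₀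
  have hB'R : ‖B'‖ < R := by
    rw [pi_norm_lt_iff hR]
    intro b
    calc ‖B' b‖ ≤ Real.pi / 2 * dist1 (W b * (W₀ b)⁻¹) := hB' b
      _ ≤ Real.pi / 2 * (R / 2) := mul_le_mul_of_nonneg_left (hclose b).le (by positivity)
      _ < 2 * (R / 2) := mul_lt_mul_of_pos_right (by linarith [Real.pi_lt_four]) (by linarith)
      _ = R := by ring
  have hsol : ∃ U₀, IsMinimizer av reg (Bj M₁ Z k) (avgFamily av (qsstarGIter0 k W)) U₀ := by
    rw [hWB]; exact hreal B' hB'R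
  exact fun177std_eq_nearValue_add_far_of_isMinimizer av reg M₁ hk0 hk hfar hW hsol

end Transfer


/-! ## §2  The (J0′) minimiser-family head of the `_ofCoercive` chain with the analyticity radius in the NEAR count -/

section AtRecord

/-- ★★★ **PROPOSITION 1 [IV] AT PRINT'S (1.74) OBJECT — THE (J0′) MINIMISER-FAMILY HEAD OF THE `_ofCoercive` CHAIN, WITH THE ANALYTIC-EXTENSION CLAUSE AT THE NEAR RADIUS** (census U3-b):
`B15Prop1CoerciveEditionNearExt.…_ofThm1TorusClass_ofMinimiserFamily_ofCoercive_nearExt` (p701805 :476) BINDERS VERBATIM — (J0′) `hMin`, (1.9) `hcoer`, `hfar`, (Gᵃ) `hZblk`, `hM2`, `hdiv`, the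
numerics `hcE0 hcE hB₃ heRa ha₀ hcA hcJ'` (near count), `h15T` — and the SAME conclusion except that the clause radius reads
`min(1∕2, R∕8, γ∕M⁵(R∕2)²∕(48(4·#plaqsOf(Ω₁(Z_i))·(1+8𝓐₀ i⁴)∕R + 1)))` (NEAR count) where it read `…Fintype.card (Plaq (F.P Kt) 0)·(1+8𝓐₀ i⁴)…` (TORUS count).  Proof: the `_nearExt` head ∘
`prop1Printed_lfVarOn_std_of_An` ∘ `anExt_nearRadius_of_jointHolomorphic` per instance, fed by the (J1)∕(J1ˢ) junctions of (J0′), `hcoer`, `hJ_of_nearValue_nearExt` over (Vn) re-derived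
from `h15T`, (181), and `transferLetter_of_minimiserFamily` (module docstring).
[cite: Balaban1989LargeFieldI, (1.74) p.192, Prop. 1 (1.77)–(1.78) p.194 (incl. the last clause), (1.79) p.195; Balaban1989LargeFieldII, (1.2)–(1.6) p.357, (1.7)–(1.9) p.358, (1.12)–(1.13) p.359, (1.15) p.359;
Balaban1985Variational, Thm 1 (8) p.279, (181) p.307, Prop. 9 (190) p.309; Balaban1988Convergent, (1.12) p.248, (2.12)–(2.14) pp.256–257] -/
theorem exists_domain_prop1Printed_lfVarOn_std_su2_box_intrinsic_analytic_atZSeqCoPRecord_ofThm1TorusClass_ofMinimiserFamily_ofCoercive_nearRadius {F : T4Family}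
    (ν : Node00.Stage7Numerics) (Kt : ℕ) (hd3 : 3 ≤ (F.P Kt).d) (h0 : 0 < (F.P Kt).d) {ι : Type}
    [hdec : ∀ j, DecidableEq (PBond (F.P Kt) j)] (hcl : hdec = fun _ a b => Classical.propDecidable (a = b))
    (Z Λ : ι → Set (Site (F.P Kt) 0)) (k : ι → ℕ) (M : ι → ℝ) (hk0 : ∀ i, 0 < k i) (hk : ∀ i, k i ≤ (F.P Kt).m + (F.P Kt).K)
    (eR : ι → ℝ) (heR : ∀ i, 0 < eR i)
    (T : ∀ i, Finset (PBond (F.P Kt) (k i)))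
    (lo hi : ι → Fin (F.P Kt).d → ℤ) (n : ι → ℕ) (hn : ∀ i κ, hi i κ ≤ lo i κ + n i) (hN : ∀ i, n i + 2 < (F.P Kt).sitesPerDir (k i))
    (hbox : ∀ i, pts (k i) (Λ i) = (castSite '' Set.Icc (lo i) (hi i) : Set (Site (F.P Kt) (k i))))
    (hZ : ∀ i, (boxPlaqs (lo i - 1) (hi i + 1) : Set (Plaq (F.P Kt) (k i))) ⊆ plaqsInside (pts (k i) (Z i)))
    (hTG0 : ∀ i, T i = (box (fun κ => (hi i κ - lo i κ + 1).toNat) (lo i)).image fun x =>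
      (⟨castSite (x - unitVec ⟨0, h0⟩), ⟨0, h0⟩⟩ : PBond (F.P Kt) (k i)))
    (hN5 : ∀ i κ, ((hi i κ - lo i κ + 1).toNat : ℤ) + 5 < (F.P Kt).sitesPerDir (k i))
    (ext : ∀ i, GaugeField (F.P Kt) (k i) SU2 → GaugeField (F.P Kt) (k i) SU2)
    (hext : ∀ i Vk, ext i Vk = extend (pts (k i) (Λ i)) (shellGauge Vk (lo i) (hi i)) Vk)
    (hlohi : ∀ i, lo i ≤ hi i)
    {γ cJ bx : ℝ} (hγ : 0 < γ) (hcJ : 0 ≤ cJ) (hbx : 0 ≤ bx)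
    (hbxM : ∀ i, 12 * ((F.P Kt).d : ℝ) * ((n i : ℝ) + 2) ^ 2 ≤ bx * (M i) ^ 2)
    {R 𝓐₀ : ι → ℝ} (hM : ∀ i, 1 ≤ (M i)) (hR : ∀ i, 0 < R i) (h𝓐₀ : ∀ i, 0 ≤ 𝓐₀ i)
    -- (J0′) ONE family along the chart family with ℂ-differentiable bounded matrix entries which at every real point IS SOME (2.12) MINIMISER of that
    -- point's datum in the class of record — print's object `U_k(V′)` of [15] Prop. 9 (190); intrinsic (not pinned to the selector `UminOfRecord`)
    (hMin : ∀ i Vk, PlaqSmallOn (plaqsInside (pts (k i) (Z i ∩ (Λ i)ᶜ))) (eR i) Vk →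
      ∃ Ũ : VecField (F.P Kt) (k i) (EuclideanSpace ℂ (Fin 3)) × VecField (F.P Kt) (k i) (EuclideanSpace ℂ (Fin 3)) →
          PBond (F.P Kt) 0 → Matrix (Fin 2) (Fin 2) ℂ,
        (∀ b a c, DifferentiableOn ℂ (fun z => Ũ z b a c) (ball 0 (R i))) ∧
        (∀ z ∈ ball (0 : VecField (F.P Kt) (k i) (EuclideanSpace ℂ (Fin 3)) × VecField (F.P Kt) (k i) (EuclideanSpace ℂ (Fin 3))) (R i),
          ∀ b a c, ‖Ũ z b a c‖ ≤ 𝓐₀ i) ∧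
        ∀ p B' : VecField (F.P Kt) (k i) E3, ‖p‖ < R i → ‖B'‖ < R i → ∃ U' : GaugeField (F.P Kt) 0 SU2,
          (∀ b, Ũ (cplxVec p, cplxVec B') b = ((U' b : SU2) : Matrix (Fin 2) (Fin 2) ℂ)) ∧
            IsMinimizer (Node00.avOfRecord F 2 Kt) (Node00.regMSCoPOfRecord F 2 ν Kt (k i) (maxDomT ν.M₁ (Z i))) (Bj ν.M₁ (Z i) (k i))
              (avgFamily (Node00.avOfRecord F 2 Kt) (qsstarGIter0 (k i) (expMul su2Chart B' (ext i (expMul su2Chart p Vk))))) U')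
    -- (L2) = (1.9) p.358 AS THE LETTER: coercivity of the slice Hessian `D(∇ sliceFn)(0)` at `eR`-regular data (dag-n12-c's `hcoer`; replaces `{γ₀} h17 hsm hγle`)
    (hcoer : ∀ i Vk, PlaqSmallOn (plaqsInside (pts (k i) (Z i ∩ (Λ i)ᶜ))) (eR i) Vk → ∀ X : GaugeSlice (pts (k i) (Λ i)) (T i) E3,
      γ / (M i) ^ 5 * ‖X‖ ^ 2 ≤ ⟪X, (fderiv ℝ (rGrad (pts (k i) (Λ i)) (T i)
              (sliceFn (pts (k i) (Λ i)) (T i)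
                (fun177std (Node00.bgMSCoPOfRecord F 2 ν Kt (k i) (maxDomT ν.M₁ (Z i))) ν.M₁ (Z i) (k i)) (ext i Vk))) 0) X⟫)
    -- the geometric letter: the k-blocks over the bonds meeting `Λ^{(k)}` lie inside `Ω₁(Z)`
    (hfar : ∀ i (b : PBond (F.P Kt) 0), b.src ∉ maxDomT ν.M₁ (Z i) 1 →
      (⟨blockIter (k i) b.src, b.dir⟩ : PBond (F.P Kt) (k i)) ∉ bondsOf (pts (k i) (Λ i)))
    -- (Gᵃ) geometry of `Z`: a union of `k`-blocks
    (hZblk : ∀ i, IsBlockUnion (k i) (Z i))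
    -- print's `M₁ ≥ 2` and the torus divisibility `L^{k}M₁ ∣ 2L^{m+K}`
    (hM2 : 2 ≤ ν.M₁) (hdiv : ∀ i, side (F.P Kt).L ν.M₁ (k i) ∣ (F.P Kt).sitesPerDir 0)
    -- bookkeeping constants
    {cE B₃ a₀ a₁' cA : ℝ} (hcE0 : 0 ≤ cE) (hcE : ∀ i, 12 * ((F.P Kt).d : ℝ) * ((n i : ℝ) + 2) ^ 2 ≤ cE) (hB₃ : 0 ≤ B₃)
    (heRa : ∀ i, (cE + 1) * eR i ≤ a₁' ∧ B₃ * ((cE + 1) * eR i) ≤ ν.εreg) (ha₀ : ν.εreg ≤ a₀)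
    (hcA : ∀ i, 1 / 2 * (B₃ * (cE + 1) * (F.P Kt).eta 1 ^ 2) ^ 2 * (Nat.card {q : Plaq (F.P Kt) 0 // q ∈ plaqsOf (maxDomT ν.M₁ (Z i) 1)} : ℝ) ≤ cA)
    -- [15] THEOREM 1 (R), CLOSED GENERAL-SEQUENCE FORM, GUARDED, IN NODE 00's TORUS-NATIVE CLASS (shape (C)) — served by K0⁷'s def (n12-d 12Q⁵)
    (h15T : ∀ (k' : ℕ), k' ≤ (F.P Kt).m + (F.P Kt).K → side (F.P Kt).L ν.M₁ k' ∣ (F.P Kt).sitesPerDir 0 →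
      ∀ (s : B14.Eq218Concrete.Seq (fun n : ℕ => Node00.unionsOfCubes (F.P Kt) (side (F.P Kt).L ν.M₁ n)) k'),
      Node00.Sect2.SeqSeparated ν.M₁ s → 0 < ν.M₁ →
      ∀ (ε₀ : ℝ) (δ : ℕ → ℝ), (∀ j, j ≤ k' → 0 < δ j ∧ δ j ≤ a₁' ∧ B₃ * δ j ≤ ε₀) → (∀ j, j < k' → δ j ≤ 2 * δ (j + 1)) →
      (∀ j, j < k' → δ (j + 1) ≤ 2 * δ j) → ε₀ ≤ a₀ →
      ∀ W : MSField (F.P Kt) SU2,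
        Node00.Sect2.DataSmall7PTop (Node00.avOfRecord F 2 Kt) s.Ω (Node00.suppDomOfRecord F ν Kt s.Ω) k' δ W →
        ∀ U₀ : GaugeField (F.P Kt) 0 SU2, IsMinimizer (Node00.avOfRecord F 2 Kt)
            {U | (∀ j, j ≤ k' → PlaqSmallOn (Node00.Sect2.omegaPlaqsTop s.Ω (Node00.suppDomOfRecord F ν Kt s.Ω) j)
                (ε₀ * (F.P Kt).eta j ^ 2) U) ∧
              Node00.Sect2.CoDivClassOnTop s.Ω (Node00.suppDomOfRecord F ν Kt s.Ω) k' ε₀ U}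
            (genSet s.Ω k') W U₀ →
          (∀ j, j ≤ k' → PlaqSmallOn (Node00.Sect2.omegaPlaqsTop s.Ω (Node00.suppDomOfRecord F ν Kt s.Ω) j)
              (B₃ * δ j * (F.P Kt).eta j ^ 2) U₀) ∧
            ∀ j, j ≤ k' → Node00.Sect2.CoDivSmallOn (Node00.Sect2.omegaBondsTop s.Ω (Node00.suppDomOfRecord F ν Kt s.Ω) j)
              (B₃ * δ j * (F.P Kt).eta j ^ 3) U₀)
    (hcJ' : ∀ i, 2 * cA * eR i / R i + 2 * ((Nat.card {q : Plaq (F.P Kt) 0 // q ∈ plaqsOf (maxDomT ν.M₁ (Z i) 1)} : ℝ) * (1 + 8 * 𝓐₀ i ^ 4)) / (R i * eR i) ≤ cJ)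
    : ∃ a₁ : ι → ℝ, (∀ i, 0 < a₁ i) ∧
      B15.Prop1Printed (lfVarOn su2Chart fun i =>
        InstOn.std (Node00.bgMSCoPOfRecord F 2 ν Kt (k i) (maxDomT ν.M₁ (Z i))) ν.M₁ (Z i) (Λ i) (k i) (M i) (a₁ i)
          (anExt (pts (k i) (Λ i)) (T i)
            (fun177std (Node00.bgMSCoPOfRecord F 2 ν Kt (k i) (maxDomT ν.M₁ (Z i))) ν.M₁ (Z i) (k i)) (ext i)
            (min (1 / 2) (min (R i / 8) (γ / (M i) ^ 5 * (R i / 2) ^ 2 /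
              (48 * (4 * ((Nat.card {q : Plaq (F.P Kt) 0 // q ∈ plaqsOf (maxDomT ν.M₁ (Z i) 1)} : ℝ) * (1 + 8 * 𝓐₀ i ^ 4)) / R i + 1))))))) := by
  -- Proposition 1 with the clause at the TOTAL radius: the `_nearExt` head
  obtain ⟨a₁, ha₁, hP⟩ :=
    exists_domain_prop1Printed_lfVarOn_std_su2_box_intrinsic_analytic_atZSeqCoPRecord_ofThm1TorusClass_ofMinimiserFamily_ofCoercive_nearExt ν Kt hd3 h0 hcl Z Λ k M
      hk0 hk eR heR T lo hi n hn hN hbox hZ hTG0 hN5 ext hext hlohi hγ hcJ hbx hbxM hM hR h𝓐₀ hMin hcoer hfar hZblk hM2 hdiv hcE0 hcE hB₃ heRa ha₀ hcA h15T hcJ'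
  subst hcl
  letI hcls : ∀ j, DecidableEq (PBond (F.P Kt) j) := fun _ a b => Classical.propDecidable (a = b)
  refine ⟨a₁, ha₁, prop1Printed_lfVarOn_std_of_An su2Chart (fun i => Node00.bgMSCoPOfRecord F 2 ν Kt (k i) (maxDomT ν.M₁ (Z i))) (fun _ => ν.M₁)
    Z Λ k M a₁ _ _ hP fun i => ?_⟩
  -- the two functions: print's (1.77) and its near part
  set f : ∀ i, GaugeField (F.P Kt) (k i) SU2 → ℝ := fun i =>
    fun177std (Node00.bgMSCoPOfRecord F 2 ν Kt (k i) (maxDomT ν.M₁ (Z i))) ν.M₁ (Z i) (k i) with hfdef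
  set fh : ∀ i, GaugeField (F.P Kt) (k i) SU2 → ℝ := fun i V =>
    wilsonLoc ((plaqsOf (maxDomT ν.M₁ (Z i) 1)).indicator fun _ => (1 : ℝ))
      (bgKZstd (Node00.bgMSCoPOfRecord F 2 ν Kt (k i) (maxDomT ν.M₁ (Z i))) ν.M₁ (Z i) (k i) V) with hfhdef
  -- (J1) and (J1ˢ) from (J0′); the dichotomy; (Vn) from `h15T`; the gradient row
  have hGj := fun i Vk (hV : PlaqSmallOn (plaqsInside (pts (k i) (Z i ∩ (Λ i)ᶜ))) (eR i) Vk) =>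
    jointHolomorphic_fun177std_bgMSCoPOfRecord_of_minimiserFamily ν Kt (k i) (maxDomT ν.M₁ (Z i)) ν.M₁ (Z i) (k i) (ext i) Vk (hMin i Vk hV)
  have hGjS := fun i Vk (hV : PlaqSmallOn (plaqsInside (pts (k i) (Z i ∩ (Λ i)ᶜ))) (eR i) Vk) =>
    jointHolomorphic_nearValue_bgMSCoPOfRecord_of_minimiserFamily ν Kt (k i) (maxDomT ν.M₁ (Z i)) ν.M₁ (Z i) (k i) (hk0 i) (ext i) Vk (h𝓐₀ i) (hMin i Vk hV)
  have hVn := nearValue_letter_of_thm1Guarded_nearCount ν Kt hd3 Z Λ k hk0 hk eR lo hi n hn hbox hZ hN5 ext hext hlohi hZblk hM2 hdiv hcE0 hcE hB₃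
    heRa ha₀ hcA (thm1Guarded_of_thm1TorusClass ν Kt (le_trans one_le_two hM2) h15T)
  have hJ := hJ_of_nearValue_nearExt Z Λ k f fh
    (fun _ _ => wilsonLoc_nonneg _ _ fun p => Set.indicator_nonneg (fun _ _ => zero_le_one) p) eR heR T ext hR hGj hGjS
    (fun i Vk _ => fun177std_dichotomy (Node00.avOfRecord F 2 Kt)
      (Node00.regMSCoPOfRecord F 2 ν Kt (k i) (maxDomT ν.M₁ (Z i))) ν.M₁ (hk0 i) (hk i) (T i) (hfar i) (ext i Vk))
    hVn hcJ'
  -- the near radius bookkeeping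
  have h𝓐S : 0 ≤ (Nat.card {q : Plaq (F.P Kt) 0 // q ∈ plaqsOf (maxDomT ν.M₁ (Z i) 1)} : ℝ) * (1 + 8 * 𝓐₀ i ^ 4) := by
    have := h𝓐₀ i; positivity
  obtain ⟨hc, hrA0, hrA2, hrr', hr'R, hr'c, hεA0, hεr', hεc, heJ0, hcJe, hrAR⟩ := near_radii_bookkeeping (hR i) h𝓐S hγ (hM i) hcJ
  set 𝓐S : ℝ := (Nat.card {q : Plaq (F.P Kt) 0 // q ∈ plaqsOf (maxDomT ν.M₁ (Z i) 1)} : ℝ) * (1 + 8 * 𝓐₀ i ^ 4) with h𝓐Sdef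
  set rA : ℝ := min (1 / 2) (min (R i / 8) (γ / (M i) ^ 5 * (R i / 2) ^ 2 / (48 * (4 * 𝓐S / R i + 1)))) with hrAdef
  set εA : ℝ := min (2 * rA) (γ / (M i) ^ 5 * (2 * rA) * (R i / 2) / (12 * (4 * 𝓐S / R i + 1))) with hεAdef
  set eJ : ℝ := γ / (M i) ^ 5 * (2 * rA) / (6 * (cJ + 1)) with heJdef
  refine ⟨min (eR i) (min εA eJ), lt_min (heR i) (lt_min hεA0 heJ0), fun ε hε hεe Vk hV => ?_⟩
  have hVR : PlaqSmallOn (plaqsInside (pts (k i) (Z i ∩ (Λ i)ᶜ))) (eR i) Vk := fun q hq => (hV q hq).trans_le (hεe.trans (min_le_left _ _))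
  refine anExt_antitone (hεe.trans ((min_le_right _ _).trans (min_le_left _ _))) ?_
  obtain ⟨𝒢, hd, hb, hr⟩ := hGj i Vk hVR
  obtain ⟨𝒢S, hdS, hbS, hrS⟩ := hGjS i Vk hVR
  -- the slice tree `G₀` gauge-fixes `Λ^{(k)}`
  have hNw : ∀ κ, hi i κ - lo i κ + 1 < ((F.P Kt).sitesPerDir (k i) : ℤ) := fun κ => by
    have h5 := hN5 i κ
    have : hi i κ - lo i κ + 1 ≤ ((hi i κ - lo i κ + 1).toNat : ℤ) := Int.self_le_toNat _
    linarith
  have hT' : TreeOrder (T i) PBond.tgt (boxDepth (lo i - e ⟨0, h0⟩) (hi i)) := by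
    rw [hTG0 i]; exact treeOrder_G0 h0 hNw
  have hv : ∀ b ∈ T i, b.tgt ∈ pts (k i) (Λ i) := fun b hb => by
    rw [hbox i]; rw [hTG0 i] at hb; exact tgt_G0_mem h0 (lo i) (hi i) b hb
  -- (181): the value invariance of (1.77)
  have hfinv : ∀ u : GaugeTransf (F.P Kt) (k i) SU2, IsGaugeOn (pts (k i) (Λ i)) u → ∀ V, f i (gaugeAct u V) = f i V := fun u _ V =>
    fun177std_bgOfRecord_gaugeAct (Node00.avOfRecord F 2 Kt)
      (B15Eq177ValueInvarianceCoDiv.gaugeAct_mem_regMSCoPOfRecord ν Kt (k i) (maxDomT ν.M₁ (Z i))) ν.M₁ (Z i) (hk i) u V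
  -- the transfer letter, discharged from the real points of (J0′)
  have htr : ∀ p : VecField (F.P Kt) (k i) E3, ‖p‖ < R i → ∃ C : ℝ, ∀ W : GaugeField (F.P Kt) (k i) SU2,
      (∀ b, b ∉ bondsOf (pts (k i) (Λ i)) → W b = ext i (expMul su2Chart p Vk) b) →
        (∀ b, dist1 (W b * (ext i (expMul su2Chart p Vk) b)⁻¹) < R i / 2) → f i W = fh i W + C := fun p hp => by
    obtain ⟨Ũ, -, -, hreal⟩ := hMin i Vk hVR
    exact transferLetter_of_minimiserFamily (Node00.avOfRecord F 2 Kt) (Node00.regMSCoPOfRecord F 2 ν Kt (k i) (maxDomT ν.M₁ (Z i))) ν.M₁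
      (hk0 i) (hk i) (hfar i) (ext i (expMul su2Chart p Vk)) (hR i)
      fun B' hB' => (hreal p B' hp hB').elim fun U' hU' => ⟨U', hU'.2⟩
  -- the gradient row at the datum
  have hj := (hJ i ε Vk hε (hεe.trans (min_le_left _ _)) hV).trans (mul_le_mul_of_nonneg_left hεe hcJ)
  have hjc : cJ * min (eR i) (min εA eJ) ≤ γ / (M i) ^ 5 * (2 * rA) / 6 :=
    (mul_le_mul_of_nonneg_left ((min_le_right _ _).trans (min_le_right _ _)) hcJ).trans hcJe
  exact anExt_nearRadius_of_jointHolomorphic hT' hv (f i) (fh i) hfinv (ext i) Vk (hR i) h𝓐S 𝒢 hd hb hr 𝒢S hdS hbS hrS htr hc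
    (hcoer i Vk hVR) hj hrA0 hrr' hr'R hr'c hεr' hεc hjc hrA2 (by linarith [hR i])

end AtRecord

end Literature.MathematicalPhysics.QuantumFieldTheory.Balaban1983to89.B15Prop1CoerciveEditionNearRadius

end
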